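import Mathlib

/-!
# TiltedLandingLaw421R3 — lens-1 (gen 9, image W): the TWO-BODY RUNG of side-block descent, PROVED

LENS-1 gen-9 module image `rh33346-cover/lens-1/TwoBody-v2.lean` (landing target `…/Theorems/TiltedLandingLaw421R3Lens1TwoBody.lean`; ONE import,
`Mathlib`; namespace `RhW08.Lens1TwoBody`; 0 `sorry`, no instances / notation / private / set_option; nothing of the tree restated — this file is
about an explicit rational function, the census model of the located law (T) of image Z `…R3Lens1SideBlock`).

WHY.  Image Z types the located petal law (T) `RhW08.Lens1SideBlock.SideBlockDescentQ` («on the circle of a strictly isolated legal top, every side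
block of petal chords finishes strictly below where it starts») and proves its chain to `TopPinning`; (T) is OPEN and its whole numerical support is
the toy census `φ₀ = P_a + R` at `a = i` (NODE v25 §2: 0 failures / 4 176 blocks, binding regime = ONE crossing mate, margin → 0⁺ at tangency).  This
file PROVES the first rung of that ladder exactly where the census is tightest: the TWO-BODY family — the pair `a = i, ā = −i` plus one mate pair
`m = x + iy, m̄` with `0 < y < 1 = Im a` (legal: not taller) and `|m| > 1` (strictly isolated) — in the `δ → 0` model (the circle through `a`).

DICTIONARY.  `G(z) = (z² + 1)((z − x)² + y²)`, `φ = G′/G = 2z/(1+z²) + 1/(z−m) + 1/(z−m̄)` (`phiM`); on the unit circle the `a`-pair is REAL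
(`2z/(1+z²) = 1/cos θ`, `pair_re_circle`), so the circle data is `h(θ) = Im[1/(e^{iθ}−m) + 1/(e^{iθ}−m̄)]` (`hM`); a chord is a maximal arc of
`{h > 0}` in the upper half circle; its walk values are `A = Re φ` at the smaller angle, `B = Re φ` at the larger; (T) for a one-chord east block
reads `B < A`.

CONTENT (all proved).
* §2 circle algebra: `one_div_mk_re/im`, `pair_re_circle`.
* §3 ★ `chordEnd_cos`: a zero `θ ∈ (0, π)` of `h` satisfies `1 − 2x cos θ + x² − y² = 0` — since
  `h = −2 sin θ((cos θ − x)² + sin²θ − y²)/(N₁N₂)`.  ★ `hM_pos_iff`: `h > 0 ⟺ 1 − 2x cos θ + x² − y² < 0` (`⟺ cos θ > (1 + x² − y²)/(2x)`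
  for `x > 0`), so the two-body family has AT MOST ONE positive arc, `[0, θ*)`, present iff `|x − 1| < y` (crossing mate): EVERY two-body
  chord is a FOOT chord, and the rung below is the complete two-body case of (T).  `matePair_re_collapse`: at such an end the mate pair
  collapses, `Re[1/(z−m) + 1/(z−m̄)] = 1/(cos θ − x)`.
* §4 the polynomial heart `qr_lt_two_p`: `(x²+y²−1)((1−x)²+y²) < 2(1+x²−y²)` for `0 < x < 2`, `y² < 1`; and `reduced_ineq`:
  with `2x c = 1 + x² − y²`, `1/c + 1/(c−x) < 1 + 2(1−x)/((1−x)²+y²)` via the exact identity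
  `RHS − LHS = d(2p − qr)/(pqr)`, `p = 1+x²−y²`, `q = x²+y²−1`, `r = (1−x)²+y²`, `d = y²−(1−x)² = 2x(1−c) > 0` (the crossing depth — the margin
  vanishes exactly at tangency `y = |x − 1|`, matching the census minimum 0.0016 at depth 10⁻³).
* §5 ★ `chordEnd_re_lt_foot`: `0<y<1`, `0<x`, `1 < x²+y²`, `θ ∈ (0, π/2)`, `h(θ) = 0` ⟹ `Re φ(e^{iθ}) < Re φ(1)`; and the typed rung
  `twoBodyFootChordDescent : TwoBodyFootChordDescent` (statement verbatim from `Cruxes/TiltedLandingLaw421R/Lines/lens1_scratch_RungR1.lean`, whose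
  extra positivity hypothesis turns out to be unnecessary).

HONESTY.  A theorem about one explicit rational function: it bears on the located law (T) only as its first proved rung (the binding regime of the
census), and on `TopPinning` / 33346 / RH not at all.  (T), (S), `TopPinning`, 33346, 33347 remain OPEN; nothing here bears on the truth of RH.
-/

open Complex

noncomputable section

namespace RhW08.Lens1TwoBody

/-! §1 Objects -/

/-- Two-body field: the pair at `a = i`, `ā = −i` (which IS `2z/(1+z²)`) plus one mate pair `m = x + iy`, `m̄`. -/
def phiM (x y : ℝ) (z : ℂ) : ℂ := 2 * z / (1 + z ^ 2) + 1 / (z - ⟨x, y⟩) + 1 / (z - ⟨x, -y⟩)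

/-- Circle data of the mate pair on the unit circle (the `a`-pair is real there). -/
def hM (x y θ : ℝ) : ℝ := (1 / (cexp (θ * I) - ⟨x, y⟩) + 1 / (cexp (θ * I) - ⟨x, -y⟩)).im

/-- RUNG R1 — TWO-BODY FOOT-CHORD DESCENT (verbatim typing of NODE v25 §5): if the circle data is positive on `(0, θ)` and vanishes at
`θ < π/2` (the foot chord `[0, θ]` of the right foot), then `Re φ` at the chord end is below its value at the foot. -/
def TwoBodyFootChordDescent : Prop :=
  ∀ x y θ : ℝ, 0 < y → y < 1 → 0 < x → 1 < x ^ 2 + y ^ 2 → 0 < θ → θ < Real.pi / 2 →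
    hM x y θ = 0 → (∀ θ' ∈ Set.Ioo 0 θ, 0 < hM x y θ') →
    (phiM x y (cexp (θ * I))).re < (phiM x y 1).re

/-! §2 Circle algebra -/

/-- Real part of `1/(a + bi)`. -/
theorem one_div_mk_re (a b : ℝ) : (1 / (⟨a, b⟩ : ℂ)).re = a / (a ^ 2 + b ^ 2) := by
  rw [one_div, Complex.inv_re, Complex.normSq_mk]; ring_nf

/-- Imaginary part of `1/(a + bi)`. -/
theorem one_div_mk_im (a b : ℝ) : (1 / (⟨a, b⟩ : ℂ)).im = -b / (a ^ 2 + b ^ 2) := by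
  rw [one_div, Complex.inv_im, Complex.normSq_mk]; ring_nf

/-- On a point `⟨c, s⟩` of the unit circle with `c ≠ 0`, the `a`-pair `2z/(1+z²)` is the REAL number `1/c`. -/
theorem pair_re_circle (c s : ℝ) (hp : c ^ 2 + s ^ 2 = 1) (hc : c ≠ 0) :
    (2 * (⟨c, s⟩ : ℂ) / (1 + (⟨c, s⟩ : ℂ) ^ 2)).re = 1 / c := by
  have hz : (⟨c, s⟩ : ℂ) ≠ 0 := fun h => hc (by simpa using congrArg Complex.re h)
  have h12 : (1 : ℂ) + (⟨c, s⟩ : ℂ) ^ 2 = ((2 * c : ℝ) : ℂ) * ⟨c, s⟩ := by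
    apply Complex.ext
    · simp [sq, Complex.mul_re]; nlinarith [hp]
    · simp [sq, Complex.mul_im]; ring
  rw [h12, mul_div_mul_right _ _ hz]
  have hcC : (c : ℂ) ≠ 0 := by exact_mod_cast hc
  have : (2 : ℂ) / ((2 * c : ℝ) : ℂ) = ((1 / c : ℝ) : ℂ) := by
    push_cast; field_simp
  rw [this, Complex.ofReal_re]

/-- The point `e^{iθ}` as a pair. -/
theorem cexp_mul_I_eq (θ : ℝ) : cexp (θ * I) = (⟨Real.cos θ, Real.sin θ⟩ : ℂ) :=
  Complex.ext (by simp [Complex.exp_ofReal_mul_I_re]) (by simp [Complex.exp_ofReal_mul_I_im])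

/-- A point of the unit circle is at positive distance from `m = x + iy` when `|m| ≠ 1`: the denominator `(c−x)² + (s−y)²` is positive. -/
theorem denom_pos (c s x y : ℝ) (hp : c ^ 2 + s ^ 2 = 1) (hs : 1 < x ^ 2 + y ^ 2) : 0 < (c - x) ^ 2 + (s - y) ^ 2 := by
  rcases (add_nonneg (sq_nonneg (c - x)) (sq_nonneg (s - y))).lt_or_eq with h | h
  · exact h
  · exfalso
    have h1 : c - x = 0 := by nlinarith [sq_nonneg (c - x), sq_nonneg (s - y)]
    have h2 : s - y = 0 := by nlinarith [sq_nonneg (c - x), sq_nonneg (s - y)]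
    have : x ^ 2 + y ^ 2 = 1 := by rw [show x = c by linarith, show y = s by linarith]; exact hp
    linarith

/-! §3 The chord end: the zero of `h` pins `cos θ`, and the mate pair collapses there -/

/-- Closed form of the circle data: `h(θ) = −2 sin θ((cos θ − x)² + sin²θ − y²)/(N₁N₂)`. -/
theorem hM_formula (x y θ : ℝ) (hs : 1 < x ^ 2 + y ^ 2) :
    hM x y θ = -(2 * Real.sin θ * ((Real.cos θ - x) ^ 2 + Real.sin θ ^ 2 - y ^ 2)) /
      (((Real.cos θ - x) ^ 2 + (Real.sin θ - y) ^ 2) * ((Real.cos θ - x) ^ 2 + (Real.sin θ + y) ^ 2)) := by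
  have pyth : Real.cos θ ^ 2 + Real.sin θ ^ 2 = 1 := Real.cos_sq_add_sin_sq θ
  have e1 : (⟨Real.cos θ, Real.sin θ⟩ : ℂ) - ⟨x, y⟩ = ⟨Real.cos θ - x, Real.sin θ - y⟩ := Complex.ext (by simp) (by simp)
  have e2 : (⟨Real.cos θ, Real.sin θ⟩ : ℂ) - ⟨x, -y⟩ = ⟨Real.cos θ - x, Real.sin θ + y⟩ :=
    Complex.ext (by simp) (by simp [sub_neg_eq_add])
  have hN1 := denom_pos (Real.cos θ) (Real.sin θ) x y pyth hs
  have hN2 : 0 < (Real.cos θ - x) ^ 2 + (Real.sin θ + y) ^ 2 := by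
    have := denom_pos (Real.cos θ) (Real.sin θ) x (-y) pyth (by simpa using hs); simpa [sub_neg_eq_add] using this
  simp only [hM, cexp_mul_I_eq, e1, e2, Complex.add_im, one_div_mk_im]
  rw [div_add_div _ _ hN1.ne' hN2.ne']
  congr 1; ring

/-- ★ The zero of the circle data pins the chord end: `h(θ) = 0`, `θ ∈ (0, π)` ⟹ `1 − 2x cos θ + x² − y² = 0`. -/
theorem chordEnd_cos (x y θ : ℝ) (hs : 1 < x ^ 2 + y ^ 2) (hθ0 : 0 < θ) (hθπ : θ < Real.pi) (hh : hM x y θ = 0) :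
    1 - 2 * x * Real.cos θ + x ^ 2 - y ^ 2 = 0 := by
  have pyth : Real.cos θ ^ 2 + Real.sin θ ^ 2 = 1 := Real.cos_sq_add_sin_sq θ
  have hsn0 : 0 < Real.sin θ := Real.sin_pos_of_pos_of_lt_pi hθ0 hθπ
  have hN1 := denom_pos (Real.cos θ) (Real.sin θ) x y pyth hs
  have hN2 : 0 < (Real.cos θ - x) ^ 2 + (Real.sin θ + y) ^ 2 := by
    have := denom_pos (Real.cos θ) (Real.sin θ) x (-y) pyth (by simpa using hs); simpa [sub_neg_eq_add] using this
  rw [hM_formula x y θ hs, div_eq_zero_iff] at hh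
  rcases hh with hh | hh
  · have : (Real.cos θ - x) ^ 2 + Real.sin θ ^ 2 - y ^ 2 = 0 := by
      rcases mul_eq_zero.1 (neg_eq_zero.1 hh) with h | h
      · exact absurd h (by positivity)
      · exact h
    linear_combination this - pyth
  · exact absurd hh (mul_pos hN1 hN2).ne'

/-- ★ EVERY TWO-BODY CHORD IS A FOOT CHORD: for `θ ∈ (0, π)` the circle data is positive iff `1 − 2x cos θ + x² − y² < 0`,
i.e. (for `x > 0`) iff `cos θ > (1 + x² − y²)/(2x)`; so `{h > 0}` is the initial arc `[0, θ*)` of the east quarter (empty unless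
`|x − 1| < y`). -/
theorem hM_pos_iff (x y θ : ℝ) (hs : 1 < x ^ 2 + y ^ 2) (hθ0 : 0 < θ) (hθπ : θ < Real.pi) :
    0 < hM x y θ ↔ 1 - 2 * x * Real.cos θ + x ^ 2 - y ^ 2 < 0 := by
  have pyth : Real.cos θ ^ 2 + Real.sin θ ^ 2 = 1 := Real.cos_sq_add_sin_sq θ
  have hsn0 : 0 < Real.sin θ := Real.sin_pos_of_pos_of_lt_pi hθ0 hθπ
  have hN1 := denom_pos (Real.cos θ) (Real.sin θ) x y pyth hs
  have hN2 : 0 < (Real.cos θ - x) ^ 2 + (Real.sin θ + y) ^ 2 := by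
    have := denom_pos (Real.cos θ) (Real.sin θ) x (-y) pyth (by simpa using hs); simpa [sub_neg_eq_add] using this
  have hQ : (Real.cos θ - x) ^ 2 + Real.sin θ ^ 2 - y ^ 2 = 1 - 2 * x * Real.cos θ + x ^ 2 - y ^ 2 := by
    linear_combination pyth
  rw [hM_formula x y θ hs, hQ, neg_div, neg_pos, div_neg_iff]
  constructor
  · rintro (⟨_, h⟩ | ⟨h, _⟩)
    · exact absurd h (not_lt.2 (mul_pos hN1 hN2).le)
    · nlinarith [mul_pos hN1 hN2]
  · intro h
    exact Or.inr ⟨by nlinarith, mul_pos hN1 hN2⟩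

/-- At a pinned end the mate pair COLLAPSES: `Re[1/(z−m) + 1/(z−m̄)] = 1/(c − x)` for `z = ⟨c, s⟩` on the unit circle with `1 − 2xc + x² − y² = 0`
(the identity `(c−x)²(N₁+N₂) = N₁N₂` modulo `c²+s² = 1` and the pinning relation). -/
theorem matePair_re_collapse (x y c s : ℝ) (hp : c ^ 2 + s ^ 2 = 1) (hs : 1 < x ^ 2 + y ^ 2) (hx : 0 < x)
    (K0 : 1 - 2 * x * c + x ^ 2 - y ^ 2 = 0) :
    (1 / ((⟨c, s⟩ : ℂ) - ⟨x, y⟩)).re + (1 / ((⟨c, s⟩ : ℂ) - ⟨x, -y⟩)).re = 1 / (c - x) := by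
  have e1 : (⟨c, s⟩ : ℂ) - ⟨x, y⟩ = ⟨c - x, s - y⟩ := Complex.ext (by simp) (by simp)
  have e2 : (⟨c, s⟩ : ℂ) - ⟨x, -y⟩ = ⟨c - x, s + y⟩ := Complex.ext (by simp) (by simp [sub_neg_eq_add])
  have hN1 := denom_pos c s x y hp hs
  have hN2 : 0 < (c - x) ^ 2 + (s + y) ^ 2 := by
    have := denom_pos c s x (-y) hp (by simpa using hs); simpa [sub_neg_eq_add] using this
  have hcx : c - x < 0 := by
    by_contra h; push Not at h
    nlinarith [mul_nonneg hx.le h]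
  have T : (c - x) ^ 2 * (((c - x) ^ 2 + (s - y) ^ 2) + ((c - x) ^ 2 + (s + y) ^ 2)) =
      ((c - x) ^ 2 + (s - y) ^ 2) * ((c - x) ^ 2 + (s + y) ^ 2) := by
    linear_combination ((c - x) ^ 2 - s ^ 2 + y ^ 2) * hp + ((c - x) ^ 2 - s ^ 2 + y ^ 2) * K0
  rw [e1, e2, one_div_mk_re, one_div_mk_re, div_add_div _ _ hN1.ne' hN2.ne', div_eq_div_iff (mul_ne_zero hN1.ne' hN2.ne') hcx.ne]
  linear_combination T

/-- Real part of the field at the right foot `z = 1`. -/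
theorem phiM_re_one (x y : ℝ) : (phiM x y 1).re = 1 + 2 * (1 - x) / ((1 - x) ^ 2 + y ^ 2) := by
  have f1 : (1 : ℂ) - ⟨x, y⟩ = ⟨1 - x, -y⟩ := Complex.ext (by simp) (by simp)
  have f2 : (1 : ℂ) - ⟨x, -y⟩ = ⟨1 - x, y⟩ := Complex.ext (by simp) (by simp)
  have f0 : (2 * (1 : ℂ) / (1 + 1 ^ 2)).re = 1 := by norm_num
  simp only [phiM, f1, f2, Complex.add_re, one_div_mk_re, f0]
  ring

/-! §4 The polynomial heart -/

/-- `q·r < 2p` on the crossing range `0 < x < 2`, `y² < 1` (chain `qr < x²r < x²((1−x)²+1) ≤ 2x² < 2p`). -/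
theorem qr_lt_two_p (x y : ℝ) (hx : 0 < x) (hx2 : x < 2) (hy2 : y ^ 2 < 1) (hq : 0 < x ^ 2 + y ^ 2 - 1) :
    (x ^ 2 + y ^ 2 - 1) * ((1 - x) ^ 2 + y ^ 2) < 2 * (1 + x ^ 2 - y ^ 2) := by
  have hr : 0 < (1 - x) ^ 2 + y ^ 2 := by nlinarith [sq_nonneg (1 - x)]
  have h1 : (x ^ 2 + y ^ 2 - 1) * ((1 - x) ^ 2 + y ^ 2) < x ^ 2 * ((1 - x) ^ 2 + y ^ 2) :=
    mul_lt_mul_of_pos_right (by linarith) hr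
  have h2 : x ^ 2 * ((1 - x) ^ 2 + y ^ 2) < x ^ 2 * ((1 - x) ^ 2 + 1) :=
    mul_lt_mul_of_pos_left (by linarith) (by positivity)
  have h3 : x ^ 2 * ((1 - x) ^ 2 + 1) ≤ 2 * x ^ 2 := by
    have : (1 - x) ^ 2 ≤ 1 := by nlinarith
    nlinarith [sq_nonneg x]
  nlinarith

/-- The reduced inequality at a pinned end `2xc = 1 + x² − y²`: `1/c + 1/(c − x) < 1 + 2(1−x)/((1−x)²+y²)`, via the exact identity
`RHS − LHS = d·(2p − qr)/(pqr)` with `p = 1+x²−y²`, `q = x²+y²−1`, `r = (1−x)²+y²`, `d = y²−(1−x)²`. -/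
theorem reduced_ineq (x y c : ℝ) (hx : 0 < x) (hy0 : 0 < y) (hy1 : y < 1) (hs : 1 < x ^ 2 + y ^ 2) (hc0 : 0 < c) (hc1 : c < 1)
    (K0 : 1 - 2 * x * c + x ^ 2 - y ^ 2 = 0) :
    1 / c + 1 / (c - x) < 1 + 2 * (1 - x) / ((1 - x) ^ 2 + y ^ 2) := by
  have hy2 : y ^ 2 < 1 := by nlinarith
  have hcx : c - x < 0 := by
    by_contra h; push Not at h
    nlinarith [mul_nonneg hx.le h]
  have hp : 0 < 1 + x ^ 2 - y ^ 2 := by nlinarith [mul_pos hx hc0]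
  have hq : 0 < x ^ 2 + y ^ 2 - 1 := by linarith
  have hr : 0 < (1 - x) ^ 2 + y ^ 2 := by positivity
  have hd : 0 < y ^ 2 - (1 - x) ^ 2 := by nlinarith [mul_pos hx (sub_pos.2 hc1)]
  have hx2 : x < 2 := by
    by_contra h; push Not at h
    linarith [mul_nonneg (sub_nonneg.2 h) hx.le]
  have key := qr_lt_two_p x y hx hx2 hy2 hq
  have ec : 1 / c = 2 * x / (1 + x ^ 2 - y ^ 2) := by
    rw [div_eq_div_iff hc0.ne' hp.ne']; linear_combination K0
  have ecx : 1 / (c - x) = -(2 * x / (x ^ 2 + y ^ 2 - 1)) := by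
    rw [← neg_div, div_eq_div_iff hcx.ne hq.ne']; linear_combination (-1 : ℝ) * K0
  rw [ec, ecx, ← sub_pos]
  have iden : 1 + 2 * (1 - x) / ((1 - x) ^ 2 + y ^ 2) - (2 * x / (1 + x ^ 2 - y ^ 2) + -(2 * x / (x ^ 2 + y ^ 2 - 1))) =
      (y ^ 2 - (1 - x) ^ 2) * (2 * (1 + x ^ 2 - y ^ 2) - (x ^ 2 + y ^ 2 - 1) * ((1 - x) ^ 2 + y ^ 2)) /
        ((1 + x ^ 2 - y ^ 2) * (x ^ 2 + y ^ 2 - 1) * ((1 - x) ^ 2 + y ^ 2)) := by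
    field_simp; ring
  rw [iden]
  exact div_pos (mul_pos hd (by linarith)) (mul_pos (mul_pos hp hq) hr)

/-! §5 The rung -/

/-- ★ TWO-BODY CHORD-END DESCENT: at any zero `θ ∈ (0, π/2)` of the circle data, `Re φ(e^{iθ}) < Re φ(1)` — the (foot) chord ending at `θ`
finishes strictly below the foot value.  No positivity hypothesis on `(0, θ)` is needed: the zero alone pins `cos θ`. -/
theorem chordEnd_re_lt_foot (x y θ : ℝ) (hy0 : 0 < y) (hy1 : y < 1) (hx : 0 < x) (hs : 1 < x ^ 2 + y ^ 2) (hθ0 : 0 < θ)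
    (hθ1 : θ < Real.pi / 2) (hh : hM x y θ = 0) : (phiM x y (cexp (θ * I))).re < (phiM x y 1).re := by
  have pyth : Real.cos θ ^ 2 + Real.sin θ ^ 2 = 1 := Real.cos_sq_add_sin_sq θ
  have hc0 : 0 < Real.cos θ := Real.cos_pos_of_mem_Ioo ⟨by linarith [Real.pi_pos], hθ1⟩
  have hsn0 : 0 < Real.sin θ := Real.sin_pos_of_pos_of_lt_pi hθ0 (by linarith [Real.pi_pos])
  have hc1 : Real.cos θ < 1 := by nlinarith
  have K0 := chordEnd_cos x y θ hs hθ0 (by linarith [Real.pi_pos]) hh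
  have hre : (phiM x y (cexp (θ * I))).re = 1 / Real.cos θ + 1 / (Real.cos θ - x) := by
    simp only [phiM, cexp_mul_I_eq, Complex.add_re, pair_re_circle (Real.cos θ) (Real.sin θ) pyth hc0.ne']
    rw [add_assoc, matePair_re_collapse x y (Real.cos θ) (Real.sin θ) pyth hs hx K0]
  rw [hre, phiM_re_one]
  exact reduced_ineq x y (Real.cos θ) hx hy0 hy1 hs hc0 hc1 K0

/-- RUNG R1 as typed (NODE v25 §5): `TwoBodyFootChordDescent` holds. -/
theorem twoBodyFootChordDescent : TwoBodyFootChordDescent :=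
  fun x y θ hy0 hy1 hx hs hθ0 hθ1 hh _ => chordEnd_re_lt_foot x y θ hy0 hy1 hx hs hθ0 hθ1 hh

/-! §6 (WALL SUPPLEMENT — scratch; becomes `TwoBodyWall-v1.lean` importing `…R3Lens1TwoBody` once W lands)
The height hypothesis `y < 1` of the rung is load-bearing and sits at the NoTallerToucher wall `y = Im a` (C6 RESULT-5b, exact numerics):
for the mate `m = 4/5 + 11i/10` — taller than `a = i` and touching it, i.e. violating `NoTallerToucher` — the foot chord exists, the circle data
is positive on `(0, θ*)` with `cos θ* = 43/160`, and the chord ASCENDS: `Re φ(1) = 33/25 < Re φ(e^{iθ*}) = 160/43 − 160/85`. -/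

/-- `(R1)_false_without_(y < 1)`: a taller touching mate makes the two-body foot chord ASCEND (explicit witness `x = 4/5`, `y = 11/10`,
`θ* = arccos (43/160)`). -/
theorem footChord_ascends_above_wall : ∃ x y θ : ℝ, 0 < x ∧ 1 < y ∧ 1 < x ^ 2 + y ^ 2 ∧ 0 < θ ∧ θ < Real.pi / 2 ∧
    hM x y θ = 0 ∧ (∀ θ' ∈ Set.Ioo 0 θ, 0 < hM x y θ') ∧ (phiM x y 1).re < (phiM x y (cexp (θ * I))).re := by
  have hs : (1 : ℝ) < (4 / 5) ^ 2 + (11 / 10) ^ 2 := by norm_num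
  have hc : Real.cos (Real.arccos (43 / 160)) = 43 / 160 := Real.cos_arccos (by norm_num) (by norm_num)
  have hθ0 : 0 < Real.arccos (43 / 160) := Real.arccos_pos.2 (by norm_num)
  have hθ1 : Real.arccos (43 / 160) < Real.pi / 2 := by rw [Real.arccos_lt_pi_div_two]; norm_num
  have pyth : Real.cos (Real.arccos (43 / 160)) ^ 2 + Real.sin (Real.arccos (43 / 160)) ^ 2 = 1 := Real.cos_sq_add_sin_sq _
  have K0 : 1 - 2 * (4 / 5 : ℝ) * Real.cos (Real.arccos (43 / 160)) + (4 / 5) ^ 2 - (11 / 10) ^ 2 = 0 := by rw [hc]; norm_num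
  refine ⟨4 / 5, 11 / 10, Real.arccos (43 / 160), by norm_num, by norm_num, hs, hθ0, hθ1, ?_, ?_, ?_⟩
  · rw [hM_formula _ _ _ hs,
      show (Real.cos (Real.arccos (43 / 160)) - 4 / 5) ^ 2 + Real.sin (Real.arccos (43 / 160)) ^ 2 - (11 / 10) ^ 2 = 0 by
        linear_combination pyth - (8 / 5) * hc]
    simp
  · intro θ' hθ'
    have hθ'π : θ' < Real.pi := by linarith [hθ'.2, Real.pi_pos]
    rw [hM_pos_iff _ _ _ hs hθ'.1 hθ'π]
    have : Real.cos (Real.arccos (43 / 160)) < Real.cos θ' := Real.cos_lt_cos_of_nonneg_of_le_pi hθ'.1.le (by linarith) hθ'.2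
    rw [hc] at this
    linarith
  · have hre : (phiM (4 / 5) (11 / 10) (cexp (Real.arccos (43 / 160) * I))).re =
        1 / Real.cos (Real.arccos (43 / 160)) + 1 / (Real.cos (Real.arccos (43 / 160)) - 4 / 5) := by
      simp only [phiM, cexp_mul_I_eq, Complex.add_re, pair_re_circle _ _ pyth (by rw [hc]; norm_num)]
      rw [add_assoc, matePair_re_collapse (4 / 5) (11 / 10) _ _ pyth hs (by norm_num) K0]
    rw [hre, phiM_re_one, hc]
    norm_num

end RhW08.Lens1TwoBody

end
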